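import Literature.AlgebraicGeometry.Frobenioids.Prop53Sub
import Literature.AlgebraicGeometry.Frobenioids.ModelFrobenioidFunctorIso
import Literature.AlgebraicGeometry.Frobenioids.ElementaryNatIsoTransport
import Literature.AlgebraicGeometry.Frobenioids.UnitTrivializationFunctor
import HarnessLib

/-!
# Frobenioids I, Corollary 5.4: the 1-commutative square `ι₁ ⋙ Ψ^rlf ≅ Ψ^istr ⋙ ι₂` AT THE DATA
# (row C54/L06 of the W3 sub-DAG, slot `FrdI.Cor54Sub.Square`, closer `square_holds`)

Mochizuki, *The geometry of Frobenioids I: the general theory*, Kyushu J. Math. **62** (2008)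
293–400, Cor. 5.4, kurims p. 104 l. 2–6: "there exists a 1-unique functor `Ψ^rlf : C₁^rlf → C₂^rlf` that
fits into a 1-commutative diagram [with the natural functors `C_i → C_i^rlf` of Proposition 5.3; the
horizontal arrows are equivalences of categories]"; proof l. 21–22: "In light of the definition of the
realification [cf. Proposition 5.3], Corollary 5.4 follows immediately from Corollaries 4.10; 4.11, (iii),
(iv)." [cite: MochizukiFrdI2008, Cor. 5.4 p.104]

PROOF-ONLY (seat abc-iut-L1-t10 gen 3; cell abc-iut, L1 sub-DAG W3 of seat abc-iut-w5-d137, row C54/L06;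
GO: abc-iut-w5-d048 / L1-lead R105b).  The typed `FrdI.Cor54Sub.Square hΦ₁ hΦ₂ Ψistr e₁ e₂ Ψrlf`
(`Prop53Sub.lean`) is a relation between binders; here it is PROVED for the data the paper means, all taken
as binders BY NAME in the shapes the tree produces them:
* `Ψ : C₁ ⥤ C₂` with its restriction `Ψistr : C₁^istr ⥤ C₂^istr` (`hΨistr : Ψistr ⋙ ι₂ ≅ ι₁ ⋙ Ψ`, Thm. 3.4 (i);
  the tree's `cor411i_restrict` gives an equality, whence `eqToIso`), and `Ψuntr : C₁^un-tr ⥤ C₂^un-tr`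
  with the square `s : Ψistr ⋙ toUntr₂ ≅ toUntr₁ ⋙ Ψuntr` of Cor. 4.11 (i);
* THE comparison equivalences `e_i : C_i^un-tr ≌ untrModel F_i` of Prop. 5.3 TOGETHER WITH their
  compatibility with the structure functors to `F_{Φ_i}` (`t_i`; seat abc-iut-L1-d5's
  `exists_untr_comparison` delivers exactly this);
* the data of Cor. 4.11 (iii)/(iv): `ΨBase`, `E = Ψ^Φ` over `ΨBase`, `η : Ψ ⋙ Base₂ ≅ Base₁ ⋙ ΨBase`,
  "`Ψ` preserves Frobenius degrees" and the Div-compatibility `Div(Ψ φ) = η_A^* E(Div φ)` (shape of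
  `PreFrobenioidData.Cor411iv`);
* the realified `Erlf = (Ψ^Φ)^rlf` lying over `E` (row C54/L02, `RlfMonoidIso`), and ANY `Ψrlf` INDUCED by
  `(ΨBase, Erlf)` (`IsInducedBy`; THE transport of row C54/L05 is one, `rlfTransport_holds`).
The proof compares the two functors `untrModel F₁ ⥤ C₂^rlf`, `G₁ := (C₁^un-tr-model → C₁^rlf) ⋙ Ψ^rlf` and
`G₂ := e₁⁻¹ ⋙ Ψ^un-tr ⋙ e₂ ⋙ (C₂^un-tr-model → C₂^rlf)`, by the device `ModelFrobenioid.nonempty_iso_of_agree`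
(`ModelFrobenioidFunctorIso.lean`): both lie over `ΨBase`, preserve Frobenius degrees, and have the same
divisors once bases are identified — the divisor bookkeeping being moved along the isomorphisms `t₂`, `s`,
`hΨistr`, `η`, `t₁`, the counit of `e₁` by `ElementaryNatIsoTransport.lean` — and pastes the unit of `e₁`
and `s`.  No statement of the paper is restated or strengthened; nothing here bears on [IUTchIII].
-/

noncomputable section

namespace Literature.AlgebraicGeometry.Frobenioids

open CategoryTheory Opposite Literature.AnabelianGeometry.EtaleTheta

universe w v₁ v₁' u₁ u₁' v₂ v₂' u₂ u₂'

namespace FrdI.Cor54Sub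

variable {D₁ : Type u₁'} [Category.{v₁'} D₁] {Φ₁ : D₁ᵒᵖ ⥤ CommMonCat.{w}}
  {C₁ : Type u₁} [Category.{v₁} C₁] (F₁ : C₁ ⥤ ElemFrobenioid Φ₁) (hΦ₁ : PreFrobenioid.IsPerfFactorialOn Φ₁)
  {D₂ : Type u₂'} [Category.{v₂'} D₂] {Φ₂ : D₂ᵒᵖ ⥤ CommMonCat.{w}}
  {C₂ : Type u₂} [Category.{v₂} C₂] (F₂ : C₂ ⥤ ElemFrobenioid Φ₂) (hΦ₂ : PreFrobenioid.IsPerfFactorialOn Φ₂)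

/-- Pasting two commutative squares `u₀ ≫ c₁ = c₁' ≫ u₁`, `u₁ ≫ c₂ = c₂' ≫ u₂` along their common edge.
[cite: MochizukiFrdI2008, Cor. 5.4 p.104] -/
private theorem paste {𝒞 : Type*} [Category 𝒞] {A₀ A₁ A₂ B₀ B₁ B₂ : 𝒞} {u₀ : A₀ ⟶ B₀} {u₁ : A₁ ⟶ B₁}
    {u₂ : A₂ ⟶ B₂} {c₁ : B₀ ⟶ B₁} {c₁' : A₀ ⟶ A₁} {c₂ : B₁ ⟶ B₂} {c₂' : A₁ ⟶ A₂}
    (h₁ : u₀ ≫ c₁ = c₁' ≫ u₁) (h₂ : u₁ ≫ c₂ = c₂' ≫ u₂) : u₀ ≫ c₁ ≫ c₂ = (c₁' ≫ c₂') ≫ u₂ := by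
  rw [← Category.assoc, h₁, Category.assoc, h₂, ← Category.assoc]

/-- **Corollary 5.4, the 1-commutative square `ι₁ ⋙ Ψ^rlf ≅ Ψ^istr ⋙ ι₂` AT THE DATA** (row C54/L06): for
the comparison equivalences `e_i` of Prop. 5.3 compatible with the structure functors to `F_{Φ_i}`, the
restriction `Ψ^istr` of `Ψ` and the `Ψ^un-tr` of Cor. 4.11 (i), the data `(ΨBase, Ψ^Φ, η)` of Cor. 4.11
(iii)/(iv) with its Div-compatibility, the realified `(Ψ^Φ)^rlf` over `Ψ^Φ`, and any `Ψ^rlf` induced by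
`(ΨBase, (Ψ^Φ)^rlf)`, the square of `FrdI.Cor54Sub.Square` 1-commutes.
[cite: MochizukiFrdI2008, Cor. 5.4 p.104] -/
theorem square_holds (hF₁ : PreFrobenioid.IsFrobenioid F₁) (hF₂ : PreFrobenioid.IsFrobenioid F₂)
    (Ψ : C₁ ⥤ C₂)
    (Ψistr : (PreFrobenioidData.ofFunctor Φ₁ F₁).Istr ⥤ (PreFrobenioidData.ofFunctor Φ₂ F₂).Istr)
    (hΨistr : Ψistr ⋙ (PreFrobenioidData.ofFunctor Φ₂ F₂).istrι ≅ (PreFrobenioidData.ofFunctor Φ₁ F₁).istrι ⋙ Ψ)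
    (Ψuntr : (PreFrobenioidData.ofFunctor Φ₁ F₁).Untr ⥤ (PreFrobenioidData.ofFunctor Φ₂ F₂).Untr)
    (s : Ψistr ⋙ (PreFrobenioidData.ofFunctor Φ₂ F₂).toUntr ≅ (PreFrobenioidData.ofFunctor Φ₁ F₁).toUntr ⋙ Ψuntr)
    (e₁ : (PreFrobenioidData.ofFunctor Φ₁ F₁).Untr ≌ PreFrobenioid.untrModel F₁)
    (e₂ : (PreFrobenioidData.ofFunctor Φ₂ F₂).Untr ≌ PreFrobenioid.untrModel F₂)
    (t₁ : e₁.functor ⋙ ModelFrobenioid.toElem Φ₁ _ _ ≅ PreFrobenioid.untrFunctor hF₁)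
    (t₂ : e₂.functor ⋙ ModelFrobenioid.toElem Φ₂ _ _ ≅ PreFrobenioid.untrFunctor hF₂)
    (ΨBase : D₁ ⥤ D₂)
    (E : PreFrobenioidData.DivisorMonoidIsoOverBase
      (PreFrobenioidData.ofFunctor Φ₁ F₁) (PreFrobenioidData.ofFunctor Φ₂ F₂) ΨBase)
    (η : Ψ ⋙ (PreFrobenioidData.ofFunctor Φ₂ F₂).base ≅ (PreFrobenioidData.ofFunctor Φ₁ F₁).base ⋙ ΨBase)
    (hdeg : ∀ ⦃A B : C₁⦄ (φ : A ⟶ B),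
      (PreFrobenioidData.ofFunctor Φ₂ F₂).degFr (Ψ.map φ) = (PreFrobenioidData.ofFunctor Φ₁ F₁).degFr φ)
    (hdiv : ∀ ⦃A B : C₁⦄ (φ : A ⟶ B),
      (PreFrobenioidData.ofFunctor Φ₂ F₂).div (Ψ.map φ) =
        (PreFrobenioidData.ofFunctor Φ₂ F₂).pull (η.hom.app A)
          (E.iso ((PreFrobenioidData.ofFunctor Φ₁ F₁).base.obj A) ((PreFrobenioidData.ofFunctor Φ₁ F₁).div φ)))
    (Erlf : PreFrobenioidData.DivisorMonoidIsoOverBase (rlfData F₁ hΦ₁) (rlfData F₂ hΦ₂) ΨBase)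
    (hErlf : ∀ (X : D₁) (x : Φ₁.obj (op X)),
      Erlf.iso X (((toRlfNatTrans Φ₁ (PreFrobenioid.IsPerfFactorialOn.op hΦ₁)).app (op X)).hom x) =
        ((toRlfNatTrans Φ₂ (PreFrobenioid.IsPerfFactorialOn.op hΦ₂)).app (op (ΨBase.obj X))).hom
          (E.iso X x))
    (Ψrlf : PreFrobenioid.rlf F₁ hΦ₁ ⥤ PreFrobenioid.rlf F₂ hΦ₂)
    (hΨrlf : IsInducedBy F₁ hΦ₁ F₂ hΦ₂ ΨBase Erlf Ψrlf) :
    Square hΦ₁ hΦ₂ Ψistr e₁ e₂ Ψrlf := by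
  obtain ⟨ηr, hdegr, hdivr⟩ := hΨrlf
  -- sharpness of the divisor monoids (perf-factorial ⇒ divisorial ⇒ trivial units)
  have hs₁ : ∀ (A : D₁) (x : Φ₁.obj (op A)), IsUnit x → x = 1 := fun A x hx =>
    (PreFrobenioid.IsPerfFactorialOn.op hΦ₁ (op A)).isDivisorial.isSharp.eq_one_of_isUnit x hx
  have hs₂ : ∀ (A : D₂) (x : Φ₂.obj (op A)), IsUnit x → x = 1 := fun A x hx =>
    (PreFrobenioid.IsPerfFactorialOn.op hΦ₂ (op A)).isDivisorial.isSharp.eq_one_of_isUnit x hx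
  -- abbreviations
  let S₁ := PreFrobenioidData.ofFunctor Φ₁ F₁
  let S₂ := PreFrobenioidData.ofFunctor Φ₂ F₂
  let G₁ : PreFrobenioid.untrModel F₁ ⥤ PreFrobenioid.rlf F₂ hΦ₂ := PreFrobenioid.untrToRlf F₁ hΦ₁ ⋙ Ψrlf
  let G₂ : PreFrobenioid.untrModel F₁ ⥤ PreFrobenioid.rlf F₂ hΦ₂ :=
    e₁.inverse ⋙ Ψuntr ⋙ e₂.functor ⋙ PreFrobenioid.untrToRlf F₂ hΦ₂
  -- the base identification of `G₂ X` with `ΨBase (Base X)`: `t₂ · s⁻¹ · hΨistr · η · ΨBase(t₁⁻¹ · counit)`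
  let U : PreFrobenioid.untrModel F₁ → S₁.Untr := fun X => e₁.inverse.obj X
  let mIso : ∀ X : PreFrobenioid.untrModel F₁, (G₂.obj X).base ≅ ΨBase.obj X.base := fun X =>
    (ElemFrobenioid.baseFunctor Φ₂).mapIso (t₂.app (Ψuntr.obj (U X))) ≪≫
      (PreFrobenioid.untrFunctor hF₂ ⋙ ElemFrobenioid.baseFunctor Φ₂).mapIso (s.app (U X).as).symm ≪≫
        S₂.base.mapIso (hΨistr.app (U X).as) ≪≫ η.app (U X).as.obj ≪≫
          ΨBase.mapIso ((ElemFrobenioid.baseFunctor Φ₁).mapIso (t₁.app (U X)).symm ≪≫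
            (ModelFrobenioid.baseFunctor _ _ _).mapIso (e₁.counitIso.app X))
  let b : ∀ X : PreFrobenioid.untrModel F₁, (G₁.obj X).base ≅ (G₂.obj X).base := fun X =>
    ηr.app ((PreFrobenioid.untrToRlf F₁ hΦ₁).obj X) ≪≫ (mIso X).symm
  -- `G₁` lies over `ΨBase`
  let γ₁ : G₁ ⋙ ModelFrobenioid.baseFunctor _ _ _ ≅ ModelFrobenioid.baseFunctor _ _ _ ⋙ ΨBase :=
    NatIso.ofComponents (fun X => ηr.app ((PreFrobenioid.untrToRlf F₁ hΦ₁).obj X))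
      (fun f => ηr.hom.naturality ((PreFrobenioid.untrToRlf F₁ hΦ₁).map f))
  /- (1) Frobenius degrees -/
  have hdeg₁' : ∀ ⦃X Y : PreFrobenioid.untrModel F₁⦄ (f : X ⟶ Y),
      ModelFrobenioid.degFr (G₁.map f) = ModelFrobenioid.degFr f := fun X Y f =>
    hdegr ((PreFrobenioid.untrToRlf F₁ hΦ₁).map f)
  -- for `G₂`: along `t₂`, `s`, `hΨistr`, `hdeg`, `t₁`, counit of `e₁`
  have hdeg₂' : ∀ ⦃X Y : PreFrobenioid.untrModel F₁⦄ (f : X ⟶ Y),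
      ModelFrobenioid.degFr (G₂.map f) = ModelFrobenioid.degFr f := by
    intro X Y f
    obtain ⟨φ, hφ⟩ := S₁.toUntr.map_surjective (e₁.inverse.map f)
    have h1 := ElemFrobenioid.degFr_map_eq_of_natIso t₂ (Ψuntr.map (e₁.inverse.map f))
    have h2 := ElemFrobenioid.degFr_map_eq_of_natIso
      (Functor.isoWhiskerRight s (PreFrobenioid.untrFunctor hF₂)) φ
    have h3 := ElemFrobenioid.degFr_map_eq_of_natIso (Functor.isoWhiskerRight hΨistr F₂) φ
    have h4 := hdeg φ.hom
    have h5 := ElemFrobenioid.degFr_map_eq_of_natIso t₁ (e₁.inverse.map f)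
    have h6 := ModelFrobenioid.degFr_map_eq_of_natIso e₁.counitIso f
    change ElemFrobenioid.degFr ((e₂.functor ⋙ ModelFrobenioid.toElem Φ₂ _ _).map
      (Ψuntr.map (e₁.inverse.map f))) = _
    rw [h1, ← hφ]
    change ElemFrobenioid.degFr (((S₁.toUntr ⋙ Ψuntr) ⋙ PreFrobenioid.untrFunctor hF₂).map φ) = _
    rw [← h2]
    change ElemFrobenioid.degFr (((Ψistr ⋙ S₂.istrι) ⋙ F₂).map φ) = _
    rw [h3]
    change S₂.degFr (Ψ.map φ.hom) = _
    rw [h4]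
    change ElemFrobenioid.degFr ((PreFrobenioid.untrFunctor hF₁).map (S₁.toUntr.map φ)) = _
    rw [hφ]
    exact h5.symm.trans h6
  /- (2) base naturality -/
  have hφx : ∀ ⦃X Y : PreFrobenioid.untrModel F₁⦄ (f : X ⟶ Y), ∃ φ : (U X).as ⟶ (U Y).as,
      S₁.toUntr.map φ = e₁.inverse.map f := fun X Y f => S₁.toUntr.map_surjective (e₁.inverse.map f)
  have hm : ∀ ⦃X Y : PreFrobenioid.untrModel F₁⦄ (f : X ⟶ Y),
      ModelFrobenioid.baseMap (G₂.map f) ≫ (mIso Y).hom = (mIso X).hom ≫ ΨBase.map (ModelFrobenioid.baseMap f) := by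
    intro X Y f
    obtain ⟨φ, hφ⟩ := hφx f
    have sq1 := ElemFrobenioid.base_map_natIso t₂ (Ψuntr.map (e₁.inverse.map f))
    have sq2 : (PreFrobenioid.untrFunctor hF₂ ⋙ ElemFrobenioid.baseFunctor Φ₂).map
          (Ψuntr.map (e₁.inverse.map f)) ≫
        (PreFrobenioid.untrFunctor hF₂ ⋙ ElemFrobenioid.baseFunctor Φ₂).map (s.inv.app (U Y).as) =
        (PreFrobenioid.untrFunctor hF₂ ⋙ ElemFrobenioid.baseFunctor Φ₂).map (s.inv.app (U X).as) ≫
          (PreFrobenioid.untrFunctor hF₂ ⋙ ElemFrobenioid.baseFunctor Φ₂).map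
            (S₂.toUntr.map (Ψistr.map φ)) := by
      rw [← Functor.map_comp, ← Functor.map_comp, ← hφ]
      exact congrArg _ (s.inv.naturality φ)
    have sq3 : S₂.base.map ((Ψistr.map φ).hom) ≫ S₂.base.map (hΨistr.hom.app (U Y).as) =
        S₂.base.map (hΨistr.hom.app (U X).as) ≫ S₂.base.map (Ψ.map φ.hom) := by
      rw [← Functor.map_comp, ← Functor.map_comp]
      exact congrArg _ (hΨistr.hom.naturality φ)
    have sq4 : S₂.base.map (Ψ.map φ.hom) ≫ η.hom.app (U Y).as.obj =
        η.hom.app (U X).as.obj ≫ ΨBase.map (S₁.base.map φ.hom) := η.hom.naturality φ.hom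
    have e45 : S₁.base.map φ.hom =
        ElemFrobenioid.Base ((PreFrobenioid.untrFunctor hF₁).map (e₁.inverse.map f)) := by
      show ElemFrobenioid.Base ((PreFrobenioid.untrFunctor hF₁).map (S₁.toUntr.map φ)) = _
      rw [hφ]
      try rfl
    have sq5 := ElemFrobenioid.base_map_natIso t₁.symm (e₁.inverse.map f)
    have sq6 := ModelFrobenioid.baseMap_map_natIso e₁.counitIso f
    have hE : ΨBase.map (ElemFrobenioid.Base ((PreFrobenioid.untrFunctor hF₁).map (e₁.inverse.map f))) ≫
        ΨBase.map (ElemFrobenioid.Base (t₁.inv.app (U Y)) ≫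
          ModelFrobenioid.baseMap (e₁.counitIso.hom.app Y)) =
        ΨBase.map (ElemFrobenioid.Base (t₁.inv.app (U X)) ≫
          ModelFrobenioid.baseMap (e₁.counitIso.hom.app X)) ≫
          ΨBase.map ((ModelFrobenioid.baseFunctor Φ₁ _ _).map f) :=
      (ΨBase.map_comp _ _).symm.trans ((congrArg ΨBase.map (paste sq5 sq6)).trans (ΨBase.map_comp _ _))
    rw [← e45] at hE
    -- paste the five squares (`mIso` unfolds definitionally)
    exact paste sq1 (paste sq2 (paste sq3 (paste sq4 hE)))
  have hbn : ∀ ⦃X Y : PreFrobenioid.untrModel F₁⦄ (f : X ⟶ Y),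
      ModelFrobenioid.baseMap (G₁.map f) ≫ (b Y).hom = (b X).hom ≫ ModelFrobenioid.baseMap (G₂.map f) := by
    intro X Y f
    have n1 : ModelFrobenioid.baseMap (G₁.map f) ≫
        ηr.hom.app ((PreFrobenioid.untrToRlf F₁ hΦ₁).obj Y) =
        ηr.hom.app ((PreFrobenioid.untrToRlf F₁ hΦ₁).obj X) ≫
          ΨBase.map ((ModelFrobenioid.baseFunctor Φ₁ _ _).map f) :=
      ηr.hom.naturality ((PreFrobenioid.untrToRlf F₁ hΦ₁).map f)
    show ModelFrobenioid.baseMap (G₁.map f) ≫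
        ηr.hom.app ((PreFrobenioid.untrToRlf F₁ hΦ₁).obj Y) ≫ (mIso Y).inv =
      (ηr.hom.app ((PreFrobenioid.untrToRlf F₁ hΦ₁).obj X) ≫ (mIso X).inv) ≫
        ModelFrobenioid.baseMap (G₂.map f)
    have hm' : ΨBase.map (ModelFrobenioid.baseMap f) ≫ (mIso Y).inv =
        (mIso X).inv ≫ ModelFrobenioid.baseMap (G₂.map f) :=
      (Iso.eq_inv_comp (mIso X)).mpr
        ((Category.assoc _ _ _).symm.trans ((Iso.comp_inv_eq (mIso Y)).mpr (hm f).symm))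
    exact paste n1 hm'
  /- (3) divisors -/
  -- naturality of `Φ₂ → Φ₂^rlf` on elements
  have natR : ∀ {A B : D₂} (m : B ⟶ A) (y : Φ₂.obj (op A)),
      ((toRlfNatTrans Φ₂ (PreFrobenioid.IsPerfFactorialOn.op hΦ₂)).app (op B)).hom (pull Φ₂ m y) =
        pull (rlfFunctor Φ₂ (PreFrobenioid.IsPerfFactorialOn.op hΦ₂)) m
          (((toRlfNatTrans Φ₂ (PreFrobenioid.IsPerfFactorialOn.op hΦ₂)).app (op A)).hom y) := by
    intro A B m y
    exact congrArg (fun g => (CommMonCat.Hom.hom g) y)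
      ((toRlfNatTrans Φ₂ (PreFrobenioid.IsPerfFactorialOn.op hΦ₂)).naturality m.op)
  have hdiv' : ∀ ⦃X Y : PreFrobenioid.untrModel F₁⦄ (f : X ⟶ Y),
      ModelFrobenioid.div (G₁.map f) =
        pull (rlfFunctor Φ₂ (PreFrobenioid.IsPerfFactorialOn.op hΦ₂)) (b X).hom
          (ModelFrobenioid.div (G₂.map f)) := by
    intro X Y f
    obtain ⟨φ, hφ⟩ := hφx f
    -- `G₁`: the hypothesis on `Ψ^rlf` and the compatibility of `E^rlf` with `E`
    have L : ModelFrobenioid.div (G₁.map f) =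
        pull (rlfFunctor Φ₂ (PreFrobenioid.IsPerfFactorialOn.op hΦ₂))
          (ηr.hom.app ((PreFrobenioid.untrToRlf F₁ hΦ₁).obj X))
          (((toRlfNatTrans Φ₂ (PreFrobenioid.IsPerfFactorialOn.op hΦ₂)).app (op (ΨBase.obj X.base))).hom
            (E.iso X.base (ModelFrobenioid.div f))) := by
      rw [← hErlf X.base (ModelFrobenioid.div f)]
      exact hdivr ((PreFrobenioid.untrToRlf F₁ hΦ₁).map f)
    -- `G₂`: chase `Div` through `t₂`, `s`, `hΨistr`, `hdiv`, `t₁`, the counit of `e₁`, and `E`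
    have c1 : ModelFrobenioid.div (e₂.functor.map (Ψuntr.map (e₁.inverse.map f))) =
        pull Φ₂ (ElemFrobenioid.Base (t₂.hom.app (Ψuntr.obj (U X))))
          (ElemFrobenioid.Div ((PreFrobenioid.untrFunctor hF₂).map (Ψuntr.map (e₁.inverse.map f)))) :=
      ElemFrobenioid.div_map_eq_of_natIso hs₂ t₂ (Ψuntr.map (e₁.inverse.map f))
    have c2 : ElemFrobenioid.Div ((PreFrobenioid.untrFunctor hF₂).map (Ψuntr.map (S₁.toUntr.map φ))) =
        pull Φ₂ (ElemFrobenioid.Base ((PreFrobenioid.untrFunctor hF₂).map (s.inv.app (U X).as)))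
          (ElemFrobenioid.Div ((PreFrobenioid.untrFunctor hF₂).map (S₂.toUntr.map (Ψistr.map φ)))) :=
      ElemFrobenioid.div_map_eq_of_natIso hs₂
        (Functor.isoWhiskerRight s (PreFrobenioid.untrFunctor hF₂)).symm φ
    rw [hφ] at c2
    have c12 := c1.trans (congrArg (pull Φ₂ (ElemFrobenioid.Base (t₂.hom.app (Ψuntr.obj (U X))))) c2)
    have c3 : ElemFrobenioid.Div ((PreFrobenioid.untrFunctor hF₂).map (S₂.toUntr.map (Ψistr.map φ))) =
        pull Φ₂ (S₂.base.map (hΨistr.hom.app (U X).as)) (ElemFrobenioid.Div (F₂.map (Ψ.map φ.hom))) :=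
      ElemFrobenioid.div_map_eq_of_natIso hs₂ (Functor.isoWhiskerRight hΨistr F₂) φ
    have c4 : ElemFrobenioid.Div (F₂.map (Ψ.map φ.hom)) =
        pull Φ₂ (η.hom.app (U X).as.obj) (E.iso (S₁.base.obj (U X).as.obj) (S₁.div φ.hom)) := hdiv φ.hom
    have c5 : S₁.div φ.hom =
        pull Φ₁ (ElemFrobenioid.Base (t₁.inv.app (U X)))
          (ModelFrobenioid.div (e₁.functor.map (S₁.toUntr.map φ))) :=
      ElemFrobenioid.div_map_eq_of_natIso hs₁ t₁.symm (S₁.toUntr.map φ)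
    rw [hφ] at c5
    have c6 : ModelFrobenioid.div (e₁.functor.map (e₁.inverse.map f)) =
        pull Φ₁ (ModelFrobenioid.baseMap (e₁.counitIso.hom.app X)) (ModelFrobenioid.div f) :=
      ModelFrobenioid.div_map_eq_of_natIso hs₁ e₁.counitIso f
    have c56 := c5.trans (congrArg (pull Φ₁ (ElemFrobenioid.Base (t₁.inv.app (U X)))) c6)
    have c7 : E.iso (S₁.base.obj (U X).as.obj) (S₁.div φ.hom) =
        pull Φ₂ (ΨBase.map (ElemFrobenioid.Base (t₁.inv.app (U X)) ≫
          ModelFrobenioid.baseMap (e₁.counitIso.hom.app X))) (E.iso X.base (ModelFrobenioid.div f)) :=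
      ((congrArg (fun x => E.iso (S₁.base.obj (U X).as.obj) x) c56).trans
        (congrArg (fun x => E.iso (S₁.base.obj (U X).as.obj) x)
          (pull_comp Φ₁ (ElemFrobenioid.Base (t₁.inv.app (U X)))
            (ModelFrobenioid.baseMap (e₁.counitIso.hom.app X)) (ModelFrobenioid.div f))).symm).trans
        (E.natural (ElemFrobenioid.Base (t₁.inv.app (U X)) ≫
          ModelFrobenioid.baseMap (e₁.counitIso.hom.app X)) (ModelFrobenioid.div f))
    -- all of `Div(e₂(Ψ^untr(e₁⁻¹ f)))` in terms of `E(Div f)`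
    have c_all := ((c12.trans (congrArg (fun y => pull Φ₂ (ElemFrobenioid.Base (t₂.hom.app (Ψuntr.obj (U X))))
        (pull Φ₂ (ElemFrobenioid.Base ((PreFrobenioid.untrFunctor hF₂).map (s.inv.app (U X).as))) y)) c3)).trans
      (congrArg (fun y => pull Φ₂ (ElemFrobenioid.Base (t₂.hom.app (Ψuntr.obj (U X))))
        (pull Φ₂ (ElemFrobenioid.Base ((PreFrobenioid.untrFunctor hF₂).map (s.inv.app (U X).as)))
          (pull Φ₂ (S₂.base.map (hΨistr.hom.app (U X).as)) y))) c4)).trans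
      (congrArg (fun y => pull Φ₂ (ElemFrobenioid.Base (t₂.hom.app (Ψuntr.obj (U X))))
        (pull Φ₂ (ElemFrobenioid.Base ((PreFrobenioid.untrFunctor hF₂).map (s.inv.app (U X).as)))
          (pull Φ₂ (S₂.base.map (hΨistr.hom.app (U X).as)) (pull Φ₂ (η.hom.app (U X).as.obj) y)))) c7)
    -- the pull-back along the composite `mIso X` splits into the five pull-backs
    have SPLIT : ∀ y : Φ₂.obj (op (ΨBase.obj X.base)), pull Φ₂ (mIso X).hom y =
        pull Φ₂ (ElemFrobenioid.Base (t₂.hom.app (Ψuntr.obj (U X))))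
          (pull Φ₂ (ElemFrobenioid.Base ((PreFrobenioid.untrFunctor hF₂).map (s.inv.app (U X).as)))
            (pull Φ₂ (S₂.base.map (hΨistr.hom.app (U X).as))
              (pull Φ₂ (η.hom.app (U X).as.obj)
                (pull Φ₂ (ΨBase.map (ElemFrobenioid.Base (t₁.inv.app (U X)) ≫
                  ModelFrobenioid.baseMap (e₁.counitIso.hom.app X))) y)))) := by
      intro y
      show pull Φ₂ (ElemFrobenioid.Base (t₂.hom.app (Ψuntr.obj (U X))) ≫
          ElemFrobenioid.Base ((PreFrobenioid.untrFunctor hF₂).map (s.inv.app (U X).as)) ≫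
            S₂.base.map (hΨistr.hom.app (U X).as) ≫ η.hom.app (U X).as.obj ≫
              ΨBase.map (ElemFrobenioid.Base (t₁.inv.app (U X)) ≫
                ModelFrobenioid.baseMap (e₁.counitIso.hom.app X))) y = _
      rw [pull_comp, pull_comp, pull_comp, pull_comp]
      try rfl
    have KEY : ModelFrobenioid.div (e₂.functor.map (Ψuntr.map (e₁.inverse.map f))) =
        pull Φ₂ (mIso X).hom (E.iso X.base (ModelFrobenioid.div f)) := c_all.trans (SPLIT _).symm
    have R : ModelFrobenioid.div (G₂.map f) =
        pull (rlfFunctor Φ₂ (PreFrobenioid.IsPerfFactorialOn.op hΦ₂)) (mIso X).hom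
          (((toRlfNatTrans Φ₂ (PreFrobenioid.IsPerfFactorialOn.op hΦ₂)).app (op (ΨBase.obj X.base))).hom
            (E.iso X.base (ModelFrobenioid.div f))) := by
      show ((toRlfNatTrans Φ₂ (PreFrobenioid.IsPerfFactorialOn.op hΦ₂)).app
          (op (e₂.functor.obj (Ψuntr.obj (U X))).base)).hom
            (ModelFrobenioid.div (e₂.functor.map (Ψuntr.map (e₁.inverse.map f)))) = _
      rw [KEY]
      exact natR _ _
    rw [L, R, ← pull_comp]
    refine congrArg (fun m => pull (rlfFunctor Φ₂ (PreFrobenioid.IsPerfFactorialOn.op hΦ₂)) m _) ?_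
    exact ((Iso.eq_comp_inv (mIso X)).mp rfl).symm
  /- (4) the rational-function monoid `ℝ · Φ₂^birat` is group-like with injective `Div_B` -/
  have hB₂ : ∀ (A : D₂ᵒᵖ) (u : (((RealificationData.canonical Φ₂ (PreFrobenioid.IsPerfFactorialOn.op hΦ₂)).realSpan
      (PreFrobenioid.biratSubfunctor F₂)).toMonoid).obj A), IsUnit u := fun A u =>
    Group.isUnit (α := ((RealificationData.canonical Φ₂ (PreFrobenioid.IsPerfFactorialOn.op hΦ₂)).realSpan
      (PreFrobenioid.biratSubfunctor F₂)).carrier (unop A)) u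
  have hinj : ∀ A : D₂ᵒᵖ, Function.Injective (divB _
      ((RealificationData.canonical Φ₂ (PreFrobenioid.IsPerfFactorialOn.op hΦ₂)).realSpan
        (PreFrobenioid.biratSubfunctor F₂)).toMonoid
      ((RealificationData.canonical Φ₂ (PreFrobenioid.IsPerfFactorialOn.op hΦ₂)).realSpan
        (PreFrobenioid.biratSubfunctor F₂)).incl A) := fun A x y h => Subtype.ext h
  /- (5) the device of `ModelFrobenioidFunctorIso`, then pasting with the unit of `e₁` and `s` -/
  obtain ⟨θ⟩ := ModelFrobenioid.nonempty_iso_of_agree b hbn hdeg₂' hdiv' hdeg₁' γ₁ hB₂ hinj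
  exact Nonempty.intro
    ((Functor.isoWhiskerLeft (S₁.toUntr ⋙ e₁.functor) θ :
        FrdI.Prop53Sub.iotaRlf F₁ hΦ₁ e₁ ⋙ Ψrlf ≅
          S₁.toUntr ⋙ (e₁.functor ⋙ e₁.inverse) ⋙ Ψuntr ⋙ e₂.functor ⋙ PreFrobenioid.untrToRlf F₂ hΦ₂) ≪≫
      Functor.isoWhiskerLeft S₁.toUntr (Functor.isoWhiskerRight e₁.unitIso.symm
        (Ψuntr ⋙ e₂.functor ⋙ PreFrobenioid.untrToRlf F₂ hΦ₂)) ≪≫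
      (Functor.isoWhiskerRight s.symm (e₂.functor ⋙ PreFrobenioid.untrToRlf F₂ hΦ₂) :
        S₁.toUntr ⋙ 𝟭 _ ⋙ Ψuntr ⋙ e₂.functor ⋙ PreFrobenioid.untrToRlf F₂ hΦ₂ ≅
          Ψistr ⋙ FrdI.Prop53Sub.iotaRlf F₂ hΦ₂ e₂))

end FrdI.Cor54Sub

end Literature.AlgebraicGeometry.Frobenioids

end
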